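import Summits.CriticalPhenomena.PercolationContinuityZ3.Theorems.PercNearOneGluingNoHeavyLowerTailSahiLatinZeroBottomBlock

/-!
# `NoHeavyLowerTail` (crux stmt-CriticalPhenomena-4575), Sahi programme (prim-master-conj gen 50): the PRODUCT DICTIONARY — points of
# `[3]^{U ⊕ V}` as pairs, CYLINDER SETS over the two blocks, and the factorisation of the link counts `N`, `Λ` ("block independence")

Support file (`--supports stmt-CriticalPhenomena-4575`; small definitions (`fstPt`, `sndPt`, `cylL`, `cylR`) + proofs, no `sorry`, standard
axioms).  Memo `run/shared/lean/prim/prim-l12/FROM-prim-master-conj-g50-GENERAL-CORE.md` §3.  Nothing here asserts the crux, Kahn's conjecture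
or (C¼).

THE MATHEMATICS.  For finite index types `U, V` a point `u ∈ [3]^{U ⊕ V}` is the pair `(ξ, η) = (fstPt u, sndPt u)` (`Equiv.sumArrowEquivProdArrow`);
the link factorises, `link u ≅ link ξ × link η` (`map_link_eq_product`), and the Latin completion acts coordinatewise (`fstPt_anti`, `sndPt_anti`).
For `S ⊆ [3]^U`, `T ⊆ [3]^V` the CYLINDERS `cylL S = S × [3]^V`, `cylR T = [3]^U × T` satisfy (`q = |V|`, `p = |U|`):
  `N_{cylL S}(u) = N_S(ξ)·2^q`,  `N_{cylR T}(u) = 2^p·N_T(η)`,  `N_{cylL S ∩ cylR T}(u) = N_S(ξ)·N_T(η)`,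
  `Λ_{cylL S, cylL S'}(u) = Λ_{S,S'}(ξ)·2^q`,  `Λ_{cylR T, cylR T'}(u) = 2^p·Λ_{T,T'}(η)`,  `Λ_{cylL S, cylR T}(u) = N_S(ξ)·N_T(η)`
(all from one counting lemma `card_filter_link_prod`), and a sum over `[3]^{U ⊕ V}` is a double sum (`sum_pt_sum_eq`).  These are the
"block independence" identities `N_{PQ} = αβ`, `M_u(P;c) = αβ̄`, … of the memo, used by the general core bound `…SahiLatinZeroBottomCoreGeneral`.
[this work]
-/

namespace Summit.CriticalPhenomena.PercolationContinuityZ3.Theorems.SahiLatin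

open Finset

variable {U V : Type*} [Fintype U] [DecidableEq U] [Fintype V] [DecidableEq V]

/-! ## §1  Pair structure of the points of `[3]^{U ⊕ V}` -/

omit [Fintype U] [DecidableEq U] [Fintype V] [DecidableEq V] in
/-- First block of a point of `[3]^{U ⊕ V}`. [this work] -/
def fstPt (u : Pt (U ⊕ V)) : Pt U := fun a => u (Sum.inl a)

omit [Fintype U] [DecidableEq U] [Fintype V] [DecidableEq V] in
/-- Second block of a point of `[3]^{U ⊕ V}`. [this work] -/
def sndPt (u : Pt (U ⊕ V)) : Pt V := fun b => u (Sum.inr b)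

omit [Fintype U] [DecidableEq U] [Fintype V] [DecidableEq V] in
/-- `fstPt` of a glued point. [this work] -/
@[simp] theorem fstPt_elim (ξ : Pt U) (η : Pt V) : fstPt (Sum.elim ξ η) = ξ := rfl

omit [Fintype U] [DecidableEq U] [Fintype V] [DecidableEq V] in
/-- `sndPt` of a glued point. [this work] -/
@[simp] theorem sndPt_elim (ξ : Pt U) (η : Pt V) : sndPt (Sum.elim ξ η) = η := rfl

omit [Fintype U] [DecidableEq U] [Fintype V] [DecidableEq V] in
/-- A point is glued from its blocks. [this work] -/
theorem elim_fstPt_sndPt (u : Pt (U ⊕ V)) : Sum.elim (fstPt u) (sndPt u) = u := by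
  funext i; cases i <;> rfl

/-- The pair equivalence `[3]^{U ⊕ V} ≃ [3]^U × [3]^V`. [this work] -/
def ptProd : Pt (U ⊕ V) ≃ Pt U × Pt V := Equiv.sumArrowEquivProdArrow U V (Fin 3)

omit [Fintype U] [DecidableEq U] [Fintype V] [DecidableEq V] in
/-- `ptProd u = (fstPt u, sndPt u)`. [this work] -/
@[simp] theorem ptProd_apply (u : Pt (U ⊕ V)) : ptProd u = (fstPt u, sndPt u) := rfl

omit [Fintype U] [DecidableEq U] [Fintype V] [DecidableEq V] in
/-- `ptProd.symm (ξ, η) = Sum.elim ξ η`. [this work] -/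
@[simp] theorem ptProd_symm_apply (z : Pt U × Pt V) : (ptProd (U := U) (V := V)).symm z = Sum.elim z.1 z.2 := rfl

omit [Fintype U] [DecidableEq U] [Fintype V] [DecidableEq V] in
/-- The Latin completion acts blockwise (first block). [this work] -/
@[simp] theorem fstPt_anti (u y : Pt (U ⊕ V)) : fstPt (anti u y) = anti (fstPt u) (fstPt y) := rfl

omit [Fintype U] [DecidableEq U] [Fintype V] [DecidableEq V] in
/-- The Latin completion acts blockwise (second block). [this work] -/
@[simp] theorem sndPt_anti (u y : Pt (U ⊕ V)) : sndPt (anti u y) = anti (sndPt u) (sndPt y) := rfl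

/-- **A sum over `[3]^{U ⊕ V}` is a double sum.** [this work] -/
theorem sum_pt_sum_eq (f : Pt (U ⊕ V) → ℤ) : ∑ u, f u = ∑ ξ : Pt U, ∑ η : Pt V, f (Sum.elim ξ η) := by
  rw [← Fintype.sum_prod_type']
  exact Fintype.sum_equiv ptProd _ _ fun u => by
    show f u = f (Sum.elim (fstPt u) (sndPt u)); rw [elim_fstPt_sndPt]

omit [DecidableEq U] [DecidableEq V] in
/-- `|U ⊕ V| = |U| + |V|` for the powers of two. [this work] -/
theorem two_pow_card_sum : (2 : ℤ) ^ Fintype.card (U ⊕ V) = 2 ^ Fintype.card U * 2 ^ Fintype.card V := by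
  rw [Fintype.card_sum, pow_add]

/-! ## §2  The link factorises -/

/-- **The link of a pair is the product of the links.** [this work] -/
theorem map_link_eq_product (u : Pt (U ⊕ V)) :
    (link u).map (ptProd (U := U) (V := V)).toEmbedding = link (fstPt u) ×ˢ link (sndPt u) := by
  ext ⟨y₁, y₂⟩
  rw [mem_map_equiv, mem_product, ptProd_symm_apply, mem_link, mem_link, mem_link, Sum.forall]
  rfl

/-- **Counting lemma**: link points with a blockwise condition are counted blockwise. [this work] -/
theorem card_filter_link_prod (u : Pt (U ⊕ V)) (p : Pt U → Prop) (q : Pt V → Prop) [DecidablePred p] [DecidablePred q] :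
    ((link u).filter fun y => p (fstPt y) ∧ q (sndPt y)).card =
      ((link (fstPt u)).filter p).card * ((link (sndPt u)).filter q).card := by
  rw [← card_product, ← filter_product, ← map_link_eq_product, filter_map, card_map]
  congr 1

/-! ## §3  Cylinder sets -/

/-- The cylinder `S × [3]^V` over a set of the first block. [this work] -/
def cylL (S : Finset (Pt U)) : Finset (Pt (U ⊕ V)) := univ.filter fun u => fstPt u ∈ S

/-- The cylinder `[3]^U × T` over a set of the second block. [this work] -/
def cylR (T : Finset (Pt V)) : Finset (Pt (U ⊕ V)) := univ.filter fun u => sndPt u ∈ T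

/-- Membership in `cylL`. [this work] -/
@[simp] theorem mem_cylL {S : Finset (Pt U)} {u : Pt (U ⊕ V)} : u ∈ (cylL S : Finset (Pt (U ⊕ V))) ↔ fstPt u ∈ S := by
  simp [cylL]

/-- Membership in `cylR`. [this work] -/
@[simp] theorem mem_cylR {T : Finset (Pt V)} {u : Pt (U ⊕ V)} : u ∈ (cylR T : Finset (Pt (U ⊕ V))) ↔ sndPt u ∈ T := by
  simp [cylR]

/-- `cylL` commutes with complements. [this work] -/
theorem cylL_compl (S : Finset (Pt U)) : (cylL Sᶜ : Finset (Pt (U ⊕ V))) = (cylL S)ᶜ := by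
  ext u; simp

/-- `cylR` commutes with complements. [this work] -/
theorem cylR_compl (T : Finset (Pt V)) : (cylR Tᶜ : Finset (Pt (U ⊕ V))) = (cylR T)ᶜ := by
  ext u; simp

/-- `ind (cylL S) u = ind S (fstPt u)`. [this work] -/
theorem ind_cylL (S : Finset (Pt U)) (u : Pt (U ⊕ V)) : ind (cylL S : Finset (Pt (U ⊕ V))) u = ind S (fstPt u) := by
  by_cases h : fstPt u ∈ S <;> simp [h]

/-- `ind (cylR T) u = ind T (sndPt u)`. [this work] -/
theorem ind_cylR (T : Finset (Pt V)) (u : Pt (U ⊕ V)) : ind (cylR T : Finset (Pt (U ⊕ V))) u = ind T (sndPt u) := by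
  by_cases h : sndPt u ∈ T <;> simp [h]

/-! ## §4  Block independence: the factorisation of `N` and `Λ` -/

/-- `N_{cylL S ∩ cylR T}(u) = N_S(ξ)·N_T(η)`. [this work] -/
theorem N_cylL_inter_cylR (S : Finset (Pt U)) (T : Finset (Pt V)) (u : Pt (U ⊕ V)) :
    N ((cylL S : Finset (Pt (U ⊕ V))) ∩ cylR T) u = N S (fstPt u) * N T (sndPt u) := by
  rw [N, N, N, ← card_filter_link_prod]
  congr 1; ext y; simp

/-- `N_{cylL S}(u) = N_S(ξ)·2^{|V|}`. [this work] -/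
theorem N_cylL (S : Finset (Pt U)) (u : Pt (U ⊕ V)) : N (cylL S : Finset (Pt (U ⊕ V))) u = N S (fstPt u) * 2 ^ Fintype.card V := by
  rw [N, N, ← card_link (sndPt u), ← filter_true_of_mem (s := link (sndPt u)) (p := fun _ => True) (fun _ _ => trivial),
    ← card_filter_link_prod]
  congr 1; ext y; simp

/-- `N_{cylR T}(u) = 2^{|U|}·N_T(η)`. [this work] -/
theorem N_cylR (T : Finset (Pt V)) (u : Pt (U ⊕ V)) : N (cylR T : Finset (Pt (U ⊕ V))) u = 2 ^ Fintype.card U * N T (sndPt u) := by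
  rw [N, N, ← card_link (fstPt u), ← filter_true_of_mem (s := link (fstPt u)) (p := fun _ => True) (fun _ _ => trivial),
    ← card_filter_link_prod]
  congr 1; ext y; simp

/-- `Λ_{cylL S, cylR T}(u) = N_S(ξ)·N_T(η)` (the antipode is a bijection of the second link). [this work] -/
theorem Lam_cylL_cylR (S : Finset (Pt U)) (T : Finset (Pt V)) (u : Pt (U ⊕ V)) :
    Lam (cylL S : Finset (Pt (U ⊕ V))) (cylR T) u = N S (fstPt u) * N T (sndPt u) := by
  rw [Lam, N, ← card_filter_anti_mem T (sndPt u), ← card_filter_link_prod]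
  congr 1; ext y; simp

/-- `Λ_{cylL S, cylL S'}(u) = Λ_{S,S'}(ξ)·2^{|V|}`. [this work] -/
theorem Lam_cylL_cylL (S S' : Finset (Pt U)) (u : Pt (U ⊕ V)) :
    Lam (cylL S : Finset (Pt (U ⊕ V))) (cylL S') u = Lam S S' (fstPt u) * 2 ^ Fintype.card V := by
  rw [Lam, Lam, ← card_link (sndPt u), ← filter_true_of_mem (s := link (sndPt u)) (p := fun _ => True) (fun _ _ => trivial),
    ← card_filter_link_prod]
  congr 1; ext y; simp [and_assoc]

/-- `Λ_{cylR T, cylR T'}(u) = 2^{|U|}·Λ_{T,T'}(η)`. [this work] -/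
theorem Lam_cylR_cylR (T T' : Finset (Pt V)) (u : Pt (U ⊕ V)) :
    Lam (cylR T : Finset (Pt (U ⊕ V))) (cylR T') u = 2 ^ Fintype.card U * Lam T T' (sndPt u) := by
  rw [Lam, Lam, ← card_link (fstPt u), ← filter_true_of_mem (s := link (fstPt u)) (p := fun _ => True) (fun _ _ => trivial),
    ← card_filter_link_prod]
  congr 1; ext y; simp

/-- The two halves of a block's link: `N_S(ξ) + N_{Sᶜ}(ξ) = 2^{|U|}`. [this work] -/
theorem N_add_N_compl (S : Finset (Pt U)) (ξ : Pt U) : N S ξ + N Sᶜ ξ = 2 ^ Fintype.card U := by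
  rw [N, N, ← card_link ξ, ← card_filter_add_card_filter_not (s := link ξ) (p := fun y => y ∈ S)]
  congr 2; ext y; simp

end Summit.CriticalPhenomena.PercolationContinuityZ3.Theorems.SahiLatin
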